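import Summits.ResolutionOfSingularities.ResolutionOfSingularities.Theorems.PurelyInseparableDim4StepKitState
import HarnessLib

/-!
# Zoo certificates ‖ K — J-006 (candidate): a kangaroo-class C1 rise at `p = 3` under the (1)∧(2) rule

[OURS · census certificate · counted 0.]  Census cell «res-dim4-pi» (D-0157 DOOR 2), TY-4 series.
Desk WORD #32 (c): J-006 CANDIDATE (eng-w1 S-2a-m1(A) PARTIAL, hand check 17:36:16Z), class (4,1) at
`p = q = 3`, variables `(x₁, x₂, x₃, x₄) = Fin 4`:

parent `a = (F = x₃⁴x₄⁸ + x₃⁵x₄⁷ = x₃⁴x₄⁷(x₃ + x₄), r = (x₃ ↦ 4, x₄ ↦ 7), exc = {x₃, x₄})`, `ord₀ F = 12`,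
shade `d = 1`; centre the plane `V(z, x₃, x₄)` — Hironaka-permissible (`ord_S F = 12 ≥ 3`) AND
condition (2) (`4 + 7 + 1 ≤ 12`), of least cardinality among the (1)∧(2)-centres (the hyperplanes `x₃`,
`x₄` are permissible but violate (2)): an `m1` = `StepM1 3` edge and a `StepHP 3` edge (NOT a MODE-1h
edge: 1h would blow up a hyperplane); `x₃`-chart at the point `x₄ = 1`: transform
`x₃⁹(x₄+1)⁷(x₄+2)` over `𝔽₃`, cleaning deletes the cubes `x₃⁹(2x₄⁶ + x₄³ + 2)`, both old components lost,
`x₃ ↦ 12 − 3 = 9`: child `k = (x₃⁹x₄² + 2x₃⁹x₄⁵ + x₃⁹x₄⁸, (x₃ ↦ 9), {x₃})`, shade `11 − 9 = 2`: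
**RISE:d 1 → 2 at p = 3** — Hauser–Perlega's translational kangaroo at e = 1 with both components lost
(`|r| + d = 12 ≡ 0 mod 3`), a cylinder over the surface case (desk class-guess KNOWN-INSTANCE).
Certified with res-dim4-p-13's `StepKit` over `ZMod 3` (`stepHP_of`/`stepM1_of … (by decide)`).
Edge-level revisit status (FC-1): REVISIT-FREE (a single edge; no earlier translated move in the
certificate).  Nothing here proves or disproves resolution of singularities in dim ≥ 4 / char p.
-/

-- house layout `Summits/<Summit>/<Problem>` doubles the namespace component (as in the Target file)
set_option linter.dupNamespace false

noncomputable section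

namespace Summit.ResolutionOfSingularities.ResolutionOfSingularities.Theorems.PIDim4

namespace ZooCert.J006

open StepKit

/-- the parent `a = (x₃⁴x₄⁸ + x₃⁵x₄⁷, (x₃ ↦ 4, x₄ ↦ 7), {x₃, x₄})` over `𝔽₃`. [folklore] -/
def a : SData 4 (ZMod 3) := ⟨[(![0, 0, 4, 8], 1), (![0, 0, 5, 7], 1)], ![0, 0, 4, 7], {2, 3}⟩
/-- the child `k = (x₃⁹x₄² + 2x₃⁹x₄⁵ + x₃⁹x₄⁸, (x₃ ↦ 9), {x₃})`. [folklore] -/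
def k : SData 4 (ZMod 3) := ⟨[(![0, 0, 9, 2], 1), (![0, 0, 9, 5], 2), (![0, 0, 9, 8], 1)], ![0, 0, 9, 0], {2}⟩
/-- the point `x₄ = 1` of the `x₃`-chart. [folklore] -/
def b : Fin 4 → ZMod 3 := ![0, 0, 0, 1]

/-- **J-006 is an HP-permissible ((1) ∧ (2)) step** — plane centre `V(z,x₃,x₄)`, `x₃`-chart, `x₄ = 1`. [folklore] -/
theorem stepHP_a_k : StepHP 3 a.toState k.toState :=
  stepHP_of {2, 3} 2 b (by decide) (by decide) (by decide) (by decide) (by decide) (by decide) (by decide)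

/-- **… and an `m1` step** (least cardinality among the (1) ∧ (2)-centres: the hyperplanes violate (2)). [folklore] -/
theorem stepM1_a_k : StepM1 3 a.toState k.toState :=
  stepM1_of {2, 3} 2 b (by decide) (by decide) (by decide) (by decide) (by decide) (by decide)

/-- it is NOT a MODE-1h edge: the hyperplane `V(z, x₃)` is Hironaka-permissible, so 1h centres are
hyperplanes. [folklore] -/
theorem not_isMode1hCentre_plane : ¬ IsMode1hCentre 3 {2, 3} a.toState.F := by
  rw [SData.toState_F, isMode1hCentre_iff]; decide

/-- shades `1 → 2`. [folklore] -/
theorem shade_a : a.toState.shade = 1 := by rw [shade_toState]; decide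
/-- see `shade_a`. [folklore] -/
theorem shade_k : k.toState.shade = 2 := by rw [shade_toState]; decide
/-- **RISE:d at p = 3.** [folklore] -/
theorem riseD_a_k : RiseD a.toState k.toState := (riseD_iff a k).mpr (by decide)

end ZooCert.J006

open ZooCert.J006 in
/-- **J-006 ‖ K (p = 3).**  In class (4,1) at `p = 3` there is an HP-permissible (and `m1`) plane-centre
edge at a translated point on which the shade rises `1 → 2`: the first kernel-certified kangaroo-class
rise at `p = 3` of the census (a cylinder over Hauser–Perlega's surface kangaroo; KNOWN-INSTANCE
candidate).  Census value only. [folklore] -/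
theorem exists_stepHP_riseD_three : ∃ s s' : State (ZMod 3), StepHP 3 s s' ∧ StepM1 3 s s' ∧ RiseD s s' :=
  ⟨a.toState, k.toState, stepHP_a_k, stepM1_a_k, riseD_a_k⟩

end Summit.ResolutionOfSingularities.ResolutionOfSingularities.Theorems.PIDim4

end
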